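import Summits.QuantumFields.GaugeBoot.TiltedBoxLimitInPlaneRP
import Summits.QuantumFields.GaugeBoot.TiltedBoxOddMidAxisRPTwoDim
import HarnessLib

/-!
# Infinite-volume limit points of the 45°-tilted boxes, part 17: link reflection positivity along the in-plane axes in two dimensions, every family

HONEST FRAMING (cell `pub-gaugeboot`, page 1 of every file): the venture produces certified bounds
on lattice expectations at stated coupling, gauge group, dimension and torus size; NOT a mass gap,
NOT a continuum limit, NOT a string tension; NOT Yang–Mills-summit-bearing (barriers
`FixedCouplingUltralocality`, `PerturbativeInvisibility`). This module proves structural facts about a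
class of infinite-volume Wilson states (which SDP constraints are exact for them); it bounds nothing.

## Content

Part 16 (`TiltedBoxLimitInPlaneRP.lean`) proved, in two dimensions (`∀ k, k = i ∨ k = j`): a tilted
limit point along (frequently) ODD square boxes is SITE-reflection positive along both in-plane axes,
one along (frequently) EVEN boxes is LINK-reflection positive along both — a dichotomy up to parity.
The missing case was link RP along odd boxes: there the link mirror `x_i ↦ 1 - x_i` of the box twists a
LAYER and is not of positive type for its closed half (`not_tiltedBox_midAxisRP_odd`). But it IS of
positive type for the REDUCED half `{1 ≤ x_i ≤ P}` in two dimensions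
(`TwoDim.tiltedBox_midAxisRP_odd_twoDim`), and a cylinder observable of `{x_i ≥ 1}` lifts into the
reduced half of every large odd box (`isRedObservable_axis_comp_tiltedLift`). Hence:

* `integral_axisLinkReflect_nonneg_of_cylinder_odd`, `linkRP_axis_of_isTiltedBoxLimitAlong_odd`,
  `linkRP_axis'_of_isTiltedBoxLimitAlong_odd` — link RP along `i` and `j` of a limit point along
  (frequently) odd boxes (every real `β`);
* **`linkRP_axes_of_mem_tiltedBoxLimitPoints`** — EVERY two-dimensional tilted limit point (every real
  `β`, every compact Hausdorff second countable `G`, continuous `ρ`) is link-reflection positive along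
  BOTH in-plane axes (a family of boxes is frequently odd or frequently even);
* `siteRP_and_linkRP_or_linkRP_of_mem_tiltedBoxLimitPoints` — the sharpened dichotomy: odd-family
  limit points are site- AND link-RP along both axes (see part 18 for the Class-B packaging).

Proof pattern: that of part 16 (Osterwalder–Seiler limit of RP states), with the reduced-half box
theorem in place of the closed-half one.

References: K. Osterwalder, E. Seiler, Ann. Phys. 110 (1978) 440, §2; E. Seiler, LNP 159 (1982)
Thm. 2.2; S. Friedli, Y. Velenik (2017) Ch. 10; A. A. Migdal, Sov. Phys. JETP 42 (1975) 413.
-/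

noncomputable section

open MeasureTheory Filter Topology
open scoped ComplexOrder ComplexConjugate
open Literature.Probability.LatticeModels (Site)
open Literature.MathematicalPhysics.QuantumLattice

namespace Summit.QuantumFields.GaugeBoot

namespace TiltedRP

variable {d : ℕ} {i j : Fin d} {N : ℕ}
variable {G : Type*} [Group G] [TopologicalSpace G] [IsTopologicalGroup G] [CompactSpace G]
  [MeasurableSpace G] [BorelSpace G] [SecondCountableTopology G]
variable (ρ : G →* Matrix (Fin N) (Fin N) ℂ)

/-! ## The link half-space lifts into the reduced half of large odd boxes -/

section Halves

variable {L : ℕ} {α : Type*}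

omit [Group G] [TopologicalSpace G] [IsTopologicalGroup G] [CompactSpace G] [MeasurableSpace G] [BorelSpace G]
  [SecondCountableTopology G] in
/-- **Link half along the in-plane axis `i`, odd box, reduced half.** A cylinder observable supported on
links `T` of the closed half `{x_i ≥ 1}` (`linkHalfEdges i`) with `x_i ≤ m` on `T`, read through the lift,
reads only the links of the REDUCED half `{1 ≤ x_i ≤ P}` (`TwoDim.IsRedLink`) of every odd square box
`M = 2P + 1` with `P ≥ m + 1`. -/
theorem isRedObservable_axis_comp_tiltedLift {P : ℕ} [NeZero P] {F : LGConfig d G → α}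
    {T : Finset (ZdEdge d)} (hF : IsCylinder F T) (hT : ∀ e ∈ T, e ∈ linkHalfEdges i) {m : ℕ}
    (hTm : ∀ e ∈ T, e.1 i ≤ m) (hP : m + 1 ≤ P) :
    ∀ U V : Config (TiltedSite d i j (2 * P + 1) (2 * P + 1) L) d G,
      (∀ l, TwoDim.IsRedLink l → U l = V l) →
      F (tiltedLift d i j (2 * P + 1) (2 * P + 1) L U) = F (tiltedLift d i j (2 * P + 1) (2 * P + 1) L V) := by
  intro U V hUV
  refine hF fun e he => ?_
  simp only [tiltedLift_apply]
  have hmem : 1 ≤ e.1 i := hT e he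
  have hm := hTm e he
  refine hUV _ ⟨?_, ?_⟩
  · show 1 ≤ (axisCoord d L (2 * P + 1) (e.1 : TiltedSite d i j (2 * P + 1) (2 * P + 1) L)).val ∧
      (axisCoord d L (2 * P + 1) (e.1 : TiltedSite d i j (2 * P + 1) (2 * P + 1) L)).val ≤ P
    have h := val_axisCoord_mk (L := L) (i := i) (j := j) (M := 2 * P + 1) (x := e.1) (by omega)
      (by push_cast; omega)
    constructor <;> omega
  · show 1 ≤ (axisCoord d L (2 * P + 1)
        ((e.1 : TiltedSite d i j (2 * P + 1) (2 * P + 1) L) + tiltedUnit d i j (2 * P + 1) (2 * P + 1) L e.2)).val ∧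
      (axisCoord d L (2 * P + 1)
        ((e.1 : TiltedSite d i j (2 * P + 1) (2 * P + 1) L) + tiltedUnit d i j (2 * P + 1) (2 * P + 1) L e.2)).val ≤ P
    rw [← mk_add_single]
    obtain ⟨h0, h1⟩ := coord_endpoint_bounds (k := i) (e := e) (by omega) hm
    have h1' : 1 ≤ (e.1 + Pi.single e.2 (1 : ℤ) : Site d) i := by
      simp only [Pi.add_apply, Pi.single_apply]
      split_ifs <;> omega
    have h := val_axisCoord_mk (L := L) (j := j) (M := 2 * P + 1) h0 (by push_cast; omega)
    constructor <;> omega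

end Halves

/-! ## Box step: the reduced-half positivity read through the lift -/

section Box

variable {M L : ℕ} [NeZero M] [NeZero L]

/-- **Box step, odd side, link mirror** (`d = 2`): on the square box of odd side `M = 2P + 1`,
`P ≥ m + 1`, the link RP pairing along `i` of the lift of a bounded measurable cylinder observable of
`{x_i ≥ 1}` with `x_i ≤ m` on its support is non-negative (`TwoDim.tiltedBox_midAxisRP_odd_twoDim`). -/
theorem box_axisLinkRP_nonneg_odd {P : ℕ} [NeZero P] (hM : M = 2 * P + 1) (hij : i ≠ j)
    (hd : ∀ k : Fin d, k = i ∨ k = j) (hρ : Continuous ρ) (β : ℝ) {F : LGConfig d G → ℂ}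
    {T : Finset (ZdEdge d)} (hFT : IsCylinder F T) (hFm : Measurable F) {C : ℝ}
    (hC : ∀ U, ‖F U‖ ≤ C) (hT : ∀ e ∈ T, e ∈ linkHalfEdges i) {m : ℕ} (hTm : ∀ e ∈ T, e.1 i ≤ m)
    (hm : m + 1 ≤ P) :
    0 ≤ ∫ U, conj (F (configLinkReflect i (tiltedLift d i j M M L U))) *
      F (tiltedLift d i j M M L U) ∂(gibbs ρ (tiltedUnit d i j M M L) β) := by
  subst hM
  have hpos := TwoDim.tiltedBox_midAxisRP_odd_twoDim ρ hij hd hρ β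
    (fun U => F (tiltedLift d i j (2 * P + 1) (2 * P + 1) L U))
    (hFm.comp (measurable_tiltedLift d i j _ _ L)) ⟨C, fun U => hC _⟩
    (isRedObservable_axis_comp_tiltedLift hFT hT hTm hm)
  simpa only [tiltedLift_configMidReflect_axis] using hpos

end Box

/-! ## The link pairing of the limit points, odd family -/

/-- **Link pairing along `i`, odd family**: if `μ` is the limit along square boxes of ODD sides
`M_k + 2 → ∞` (`d = 2`), then `∫ conj F(configLinkReflect i U) F(U) dμ ≥ 0` for every bounded
continuous cylinder observable `F` of `{x_i ≥ 1}` (every real `β`). -/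
theorem integral_axisLinkReflect_nonneg_of_cylinder_odd (hij : i ≠ j) (hd : ∀ k : Fin d, k = i ∨ k = j)
    (hρ : Continuous ρ) {β : ℝ} {M Q : ℕ → ℕ} {μ : Measure (LGConfig d G)}
    (h : IsTiltedBoxLimitAlong d i j ρ β M Q μ) (hM : Tendsto M atTop atTop)
    (hodd : ∀ k, Odd (M k + 2)) {F : LGConfig d G → ℂ} {T : Finset (ZdEdge d)}
    (hFT : IsCylinder F T) (hFc : Continuous F) {C : ℝ} (hC : ∀ U, ‖F U‖ ≤ C)
    (hFS : DependsOn F (linkHalfEdges i)) :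
    0 ≤ ∫ U, conj (F (configLinkReflect i U)) * F U ∂μ := by
  classical
  set T' : Finset (ZdEdge d) := T.filter (· ∈ linkHalfEdges (d := d) i) with hT'
  have hFT' : IsCylinder F T' := isCylinder_filter_of_dependsOn hFT hFS
  have hTh : ∀ e ∈ T', e ∈ linkHalfEdges i := fun e he => (Finset.mem_filter.1 he).2
  obtain ⟨m, hm⟩ : ∃ m : ℕ, ∀ e ∈ T', e.1 i ≤ m := by
    refine ⟨T'.sup fun e => (e.1 i).toNat, fun e he => ?_⟩
    have hle := Finset.le_sup (f := fun e : ZdEdge d => (e.1 i).toNat) he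
    have : (e.1 i).toNat ≤ T'.sup fun e : ZdEdge d => (e.1 i).toNat := hle
    omega
  set H : LGConfig d G → ℂ := fun U => conj (F (configLinkReflect i U)) * F U with hH
  have hHc : Continuous H :=
    (Complex.continuous_conj.comp (hFc.comp (continuous_configLinkReflect i))).mul hFc
  obtain ⟨T₁, hT₁⟩ : ∃ T₁ : Finset (ZdEdge d), IsCylinder (F ∘ configLinkReflect i) T₁ :=
    ⟨_, isCylinder_comp_configLinkReflect hFT i⟩
  have hHcyl : IsCylinder H (T₁ ∪ T) := by
    intro U V hUV
    have e1 := hT₁ fun e he => hUV e (by rw [Finset.coe_union]; exact Or.inl he)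
    have e2 := hFT fun e he => hUV e (by rw [Finset.coe_union]; exact Or.inr he)
    simp only [Function.comp_apply] at e1
    simp only [hH, e1, e2]
  have hHb : ∀ U, ‖H U‖ ≤ C * C := fun U => by
    simp only [hH, norm_mul, Complex.norm_conj]
    exact mul_le_mul (hC _) (hC _) (norm_nonneg _) ((norm_nonneg (F U)).trans (hC U))
  refine h.integral_nonneg_of_eventually hρ hHcyl hHc hHb ?_
  have hev : ∀ᶠ k in atTop, 2 * m + 1 ≤ M k := hM.eventually_ge_atTop (2 * m + 1)
  refine hev.mono fun k hk => ?_
  obtain ⟨P, hP⟩ := hodd k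
  haveI : NeZero P := ⟨by omega⟩
  exact box_axisLinkRP_nonneg_odd ρ hP hij hd hρ β hFT' hFc.measurable hC hTh hm (by omega)

/-! ## Link reflection positivity along the in-plane axes, every family -/

variable [T2Space G]

/-- **Link RP along `i` of a limit point along (frequently) odd boxes** (`d = 2`, every real `β`):
all bounded measurable observables of the closed half `{x_i ≥ 1}`. -/
theorem linkRP_axis_of_isTiltedBoxLimitAlong_odd (hij : i ≠ j) (hd : ∀ k : Fin d, k = i ∨ k = j)
    (hρ : Continuous ρ) {β : ℝ} {M Q : ℕ → ℕ} {μ : Measure (LGConfig d G)}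
    (h : IsTiltedBoxLimitAlong d i j ρ β M Q μ) (hM : Tendsto M atTop atTop)
    (hQ : Tendsto Q atTop atTop) (hodd : ∃ᶠ k in atTop, Odd (M k + 2)) :
    IsReflectionPositiveFor (configLinkReflect (G := G) i) (linkHalfEdges i) μ := by
  obtain ⟨φ, hφ, hφodd⟩ := extraction_of_frequently_atTop hodd
  have hμ : μ ∈ tiltedBoxLimitPoints d i j ρ β := ⟨M, Q, hM, hQ, h⟩
  haveI := isProbabilityMeasure_of_mem_tiltedBoxLimitPoints hμ
  exact IsReflectionPositiveFor.of_continuous_cylinder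
    (measurePreserving_configLinkReflect
      (isZdTranslationInvariant_of_mem_tiltedBoxLimitPoints ρ hρ hμ)
      (reflectInvariant_of_mem_tiltedBoxLimitPoints ρ hij hρ hμ i))
    fun F T hFT hFc ⟨C, hC⟩ hFS =>
      integral_axisLinkReflect_nonneg_of_cylinder_odd ρ hij hd hρ (h.comp_strictMono ρ hφ)
        (hM.comp hφ.tendsto_atTop) hφodd hFT hFc hC hFS

/-- **Link RP along the other in-plane axis `j`** of a limit point along (frequently) odd boxes. -/
theorem linkRP_axis'_of_isTiltedBoxLimitAlong_odd (hij : i ≠ j) (hd : ∀ k : Fin d, k = i ∨ k = j)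
    (hρ : Continuous ρ) {β : ℝ} {M Q : ℕ → ℕ} {μ : Measure (LGConfig d G)}
    (h : IsTiltedBoxLimitAlong d i j ρ β M Q μ) (hM : Tendsto M atTop atTop)
    (hQ : Tendsto Q atTop atTop) (hodd : ∃ᶠ k in atTop, Odd (M k + 2)) :
    IsReflectionPositiveFor (configLinkReflect (G := G) j) (linkHalfEdges j) μ :=
  IsReflectionPositiveFor.of_conj
    (measurePreserving_configPerm_swap_of_mem_tiltedBoxLimitPoints ρ hij hρ ⟨M, Q, hM, hQ, h⟩)
    (measurable_configLinkReflect i) (configPerm_swap_configPerm_swap' i j)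
    (configLinkReflect_eq_conj_swap i j) (dependsOn_comp_configPerm_swap_linkHalf i j)
    (linkRP_axis_of_isTiltedBoxLimitAlong_odd ρ hij hd hρ h hM hQ hodd)

/-- **Link RP along both in-plane axes of a limit point along ANY family of square boxes** (`d = 2`,
every real `β`): the family is frequently odd (this part) or frequently even (part 16). -/
theorem linkRP_axes_of_isTiltedBoxLimitAlong (hij : i ≠ j) (hd : ∀ k : Fin d, k = i ∨ k = j)
    (hρ : Continuous ρ) {β : ℝ} {M Q : ℕ → ℕ} {μ : Measure (LGConfig d G)}
    (h : IsTiltedBoxLimitAlong d i j ρ β M Q μ) (hM : Tendsto M atTop atTop)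
    (hQ : Tendsto Q atTop atTop) :
    IsReflectionPositiveFor (configLinkReflect (G := G) i) (linkHalfEdges i) μ ∧
      IsReflectionPositiveFor (configLinkReflect (G := G) j) (linkHalfEdges j) μ := by
  by_cases hodd : ∃ᶠ k in atTop, Odd (M k + 2)
  · exact ⟨linkRP_axis_of_isTiltedBoxLimitAlong_odd ρ hij hd hρ h hM hQ hodd,
      linkRP_axis'_of_isTiltedBoxLimitAlong_odd ρ hij hd hρ h hM hQ hodd⟩
  · have heven : ∃ᶠ k in atTop, Even (M k + 2) := by
      rw [not_frequently] at hodd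
      exact (hodd.mono fun k hk => Nat.not_odd_iff_even.1 hk).frequently
    exact ⟨linkRP_axis_of_isTiltedBoxLimitAlong ρ hij hd hρ h hM hQ heven,
      linkRP_axis'_of_isTiltedBoxLimitAlong ρ hij hd hρ h hM hQ heven⟩

/-- **Every two-dimensional tilted limit point is link-reflection positive along BOTH in-plane axes**
(`i ≠ j` exhausting the axes, compact Hausdorff second countable `G`, continuous `ρ`, every real `β`):
`0 ≤ ∫ conj F(Θ_link U) F(U) dμ` for every bounded measurable observable `F` of `{x_i ≥ 1}`, resp.
`{x_j ≥ 1}` — Kazakov–Zheng's link positivity blocks along the in-plane axes are exact constraints on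
every such state. -/
theorem linkRP_axes_of_mem_tiltedBoxLimitPoints (hij : i ≠ j) (hd : ∀ k : Fin d, k = i ∨ k = j)
    (hρ : Continuous ρ) {β : ℝ} {μ : Measure (LGConfig d G)} (hμ : μ ∈ tiltedBoxLimitPoints d i j ρ β) :
    IsReflectionPositiveFor (configLinkReflect (G := G) i) (linkHalfEdges i) μ ∧
      IsReflectionPositiveFor (configLinkReflect (G := G) j) (linkHalfEdges j) μ := by
  obtain ⟨M, Q, hM, hQ, h⟩ := hμ
  exact linkRP_axes_of_isTiltedBoxLimitAlong ρ hij hd hρ h hM hQ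

/-- **Link RP along every axis of a two-dimensional tilted limit point** (the `linkRP` field of
`ClassBState`, `d = 2`). -/
theorem linkRP_all_of_mem_tiltedBoxLimitPoints (hij : i ≠ j) (hd : ∀ k : Fin d, k = i ∨ k = j)
    (hρ : Continuous ρ) {β : ℝ} {μ : Measure (LGConfig d G)} (hμ : μ ∈ tiltedBoxLimitPoints d i j ρ β)
    (k : Fin d) : IsReflectionPositiveFor (configLinkReflect (G := G) k) (linkHalfEdges k) μ := by
  obtain ⟨h1, h2⟩ := linkRP_axes_of_mem_tiltedBoxLimitPoints ρ hij hd hρ hμ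
  rcases hd k with rfl | rfl
  · exact h1
  · exact h2

/-- **The sharpened dichotomy**: every two-dimensional tilted limit point is link-RP along both
in-plane axes, and a limit point along (frequently) odd boxes is moreover site-RP along both. -/
theorem siteRP_and_linkRP_of_isTiltedBoxLimitAlong_odd (hij : i ≠ j) (hd : ∀ k : Fin d, k = i ∨ k = j)
    (hρ : Continuous ρ) {β : ℝ} {M Q : ℕ → ℕ} {μ : Measure (LGConfig d G)}
    (h : IsTiltedBoxLimitAlong d i j ρ β M Q μ) (hM : Tendsto M atTop atTop)
    (hQ : Tendsto Q atTop atTop) (hodd : ∃ᶠ k in atTop, Odd (M k + 2)) (k : Fin d) :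
    IsReflectionPositiveFor (configSiteReflect (G := G) k) (siteHalfEdges k) μ ∧
      IsReflectionPositiveFor (configLinkReflect (G := G) k) (linkHalfEdges k) μ := by
  refine ⟨?_, linkRP_all_of_mem_tiltedBoxLimitPoints ρ hij hd hρ ⟨M, Q, hM, hQ, h⟩ k⟩
  rcases hd k with rfl | rfl
  · exact siteRP_axis_of_isTiltedBoxLimitAlong ρ hij hd hρ h hM hQ hodd
  · exact siteRP_axis'_of_isTiltedBoxLimitAlong ρ hij hd hρ h hM hQ hodd

end TiltedRP

end Summit.QuantumFields.GaugeBoot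

end
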